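import Summits.HubbardSuperconductivity.HubbardSuperconductivity.Theorems.KLProgrammeKLRegimeScaleZeroRecordPairCertA
import Summits.HubbardSuperconductivity.HubbardSuperconductivity.Theorems.KLProgrammeKLRegimeFlowReadScaleZeroSunsetCertRowsInnerGapRecords

/-!
# Route `KLProgramme`, crux K3 — ENGINE (stmt-HubbardSuperconductivity-20437), row (C) `stub_twoLeg_curvature`, the SCALE-0 PRIVATE PAIR of `hres′` FROM THE RECORD ROWS,
# part 6: TURNKEY FROM THE #22a RECORD LIST (✓ p715778 `sunsetRows_window_innerGap_of_chain`) — the glue this lineage's window reader was built for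

Seat hubbard-kl-k3c5-p1 (g20; lineage owner of #22a).  Part 5 (`…ScaleZeroRecordPairCertA`) reduced the scale-`0` member of `hres′`, given `hcertA : KlwjCertA`, to ONE
pointwise record hypothesis in the currency {#22a rows k = 1, 2 (`bS₁, bS₂`); #22b rows k = 3, 4 (`sS₃, sS₄`); four numeric fits}.  Here the #22a part is taken from the
RECORD LIST exactly as the window reader of this lineage states it (bundles `SunsetCellBundle` = near record + inner far-gap record + rational majorants + budget row,
far-sup record `rs`, rational `ω₁ u₀ u₂`, chain cover of `klWindowC = [-21/20, -3/20]`, the three certificate predicates, `SideOK3`), plus two RATIONAL fit checks per bundle: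
* `klTailBookU_le_half_pow_twenty` (the closer's `U ≤ klEngU₀12GQ ≤ klTailBookU` is below the reader's `U ≤ 2⁻²⁰`);
* **`twoLegRead_frameZero_registered_klEngGQ_of_chain_certA`** — for EVERY `G`, `Q`, under the (C) closer's literal binders, the REGISTERED scale-`0` pair, from
  `hcertA`, the #22a list data, `hfit12 : ∀ b ∈ l, 3.19·bS₁ + δ ≤ 2¹⁰ ∧ 3.19²·bS₂ + 24.12·bS₁ + δ ≤ 2⁴` (over `ℚ`, `decide`/`norm_num` per literal), and a window-level
  #22b hypothesis `hSjetW` with its table `sS` (`sS₃ + δ ≤ 2⁴`, `sS₄ + δ ≤ 2¹¹`), `δ = (1 + 3.19 + 24.12 + 240 + 7430)⁴/10⁷⁸`.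
When KIT JOB A (near), B′ (inner far gap) and the far-sup record exist: build `l`, close `hc/hr/hrs` by the certificate lane, `hside/hfit12/hne/hhead/hlast/hchain` by
`decide`/`norm_num`, and the scale-`0` member of `hres′` is one application (the #22b table is k3c3-p1's ENGINE-1/2 record).
Proofs only; no definitions; nothing here asserts (C), any stub of 20437, K3 or superconductivity; every record/certificate is a HYPOTHESIS (kit, FROZEN).
References: BGM 2006 §2.3–§2.4 Lemma 2.1 (2.36)–(2.42) [cite: BenfattoGiulianiMastropietro2006].
-/

noncomputable section

namespace Summit.HubbardSuperconductivity.HubbardSuperconductivity.Theorems.KLRegimeSplit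

set_option linter.dupNamespace false -- summit = problem name (single-conjunct summit), D-0017
set_option exponentiation.threshold 4096 -- `klTailBookU = 10⁻³⁰⁰` bookkeeping

open Real Finset Complex Literature.MathematicalPhysics.QuantumLattice Literature.Probability.LatticeModels GrassmannAlgebra Matrix
open Literature.MathematicalPhysics.QuantumLattice.FermiRG Literature.Probability.LatticeModels.BattleFederbush
open Summit.HubbardSuperconductivity.HubbardSuperconductivity.Theorems.KLProgrammeLegKernels
open Summit.HubbardSuperconductivity.HubbardSuperconductivity.Theorems.TwoLegFourier
open Summit.HubbardSuperconductivity.HubbardSuperconductivity.Theorems.EngineV8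
open Summit.HubbardSuperconductivity.HubbardSuperconductivity.Theorems.PerturbedFermiCurve
open Summit.HubbardSuperconductivity.HubbardSuperconductivity.Theorems.DispersionFlow
open scoped Nat

variable {L M : ℕ} [NeZero L] [NeZero M] {μ U β : ℝ}

/-! ## §1 The coupling ceiling of the closer is below the reader's -/

omit [NeZero L] [NeZero M] in
/-- `klTailBookU = 10⁻³⁰⁰ ≤ 2⁻²⁰` (the #22a window reader's coupling binder). -/
theorem klTailBookU_le_half_pow_twenty : klTailBookU ≤ (2 : ℝ)⁻¹ ^ 20 := by
  unfold klTailBookU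
  rw [inv_pow, one_div]
  exact inv_anti₀ (by positivity) (by norm_num)

/-! ## §2 The (C) closer's prefix form from the #22a RECORD LIST, `KlwjCertA`, and a window-level #22b hypothesis -/

/-- **THE SCALE-0 MEMBER OF ROW (C) FROM THE #22a RECORD LIST** (TURNKEY for KIT JOB A / B′ / far-sup records): given `hcertA : KlwjCertA`, a list of #22a bundles
chain-covering `klWindowC` with their certificates and decidable side conditions — EXACTLY the hypotheses of ✓ p715778 `sunsetRows_window_innerGap_of_chain` — plus,
per bundle, the two RATIONAL fit checks `3.19·bS₁ + δ ≤ 2¹⁰`, `3.19²·bS₂ + 24.12·bS₁ + δ ≤ 2⁴` (`decide`/`norm_num` on literals), and a window-level #22b hypothesis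
(rows k = 3, 4 against a table `sS` with `sS₃ + δ ≤ 2⁴`, `sS₄ + δ ≤ 2¹¹`): for EVERY `G`, `Q`, under the (C) closer's literal binders,
`TwoLegReadJetBound L M klC4aJetC2 (klC4aJetC′ P R) β U μ (K₀) 0 ∧ TwoLegReadOscAt L M (klReadOscC P R) β U μ (K₀) 0`. [cite: BenfattoGiulianiMastropietro2006, §2.3-§2.4 (2.36)-(2.42)] -/
theorem twoLegRead_frameZero_registered_klEngGQ_of_chain_certA (G : GeoConsts) (Q : EngConsts) (hA : KlwjCertA)
    (l : List SunsetCellBundle) (rs : SunsetFarSupRecord) (ω₁ u₀ u₂ : ℚ)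
    (hne : l.map (fun b => (b.c.μlo, b.c.μhi)) ≠ [])
    (hhead : ∀ c ∈ (l.map (fun b => (b.c.μlo, b.c.μhi))).head?, c.1 ≤ (-21) / 20)
    (hlast : ∀ c ∈ (l.map (fun b => (b.c.μlo, b.c.μhi))).getLast?, (-3) / 20 ≤ c.2)
    (hchain : (l.map (fun b => (b.c.μlo, b.c.μhi))).IsChain (fun c d => d.1 ≤ c.2))
    (hc : ∀ b ∈ l, ScaleZeroSunsetCertV3 b.c) (hr : ∀ b ∈ l, ScaleZeroFarGapCert b.c.toSunsetCellRecordV2 b.r)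
    (hrs : ∀ b ∈ l, ScaleZeroFarSupCert b.c.toSunsetCellRecordV2 rs) (hside : ∀ b ∈ l, b.SideOK3 rs ω₁ u₀ u₂)
    (hfit12 : ∀ b ∈ l, b.bS 1 * ((319 : ℚ) / 100) + (1 + (319 : ℚ) / 100 + 2412 / 100 + 240 + 7430) ^ 4 / (10 : ℚ) ^ 78 ≤ (2 : ℚ) ^ 10 ∧
      b.bS 2 * ((319 : ℚ) / 100) ^ 2 + b.bS 1 * ((2412 : ℚ) / 100) + (1 + (319 : ℚ) / 100 + 2412 / 100 + 240 + 7430) ^ 4 / (10 : ℚ) ^ 78 ≤ (2 : ℚ) ^ 4)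
    {sS : ℕ → ℝ} (hfit34 : sS 3 + (1 + (319 : ℝ) / 100 + 2412 / 100 + 240 + 7430) ^ 4 / (10 : ℝ) ^ 78 ≤ (2 : ℝ) ^ 4 ∧ sS 4 + (1 + (319 : ℝ) / 100 + 2412 / 100 + 240 + 7430) ^ 4 / (10 : ℝ) ^ 78 ≤ (2 : ℝ) ^ 11)
    (hSjetW : ∀ (μ U β : ℝ) (L M : ℕ) [NeZero L] [NeZero M], μ ∈ klWindowC → 0 < U → U ≤ klTailBookU → klBetaMin ≤ β →
      klEngL₃ β U ≤ L → klEngM₃ β U L ≤ M →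
      ∀ k, 3 ≤ k → k ≤ 4 → ∀ θ : ℝ, |iteratedDeriv k (fun θ : ℝ => evalM (symInterp L (fun pp : TorusSite 2 L =>
          (∑ σσ : Fin 2, ((selfEnergy L M β (ExteriorAlgebra.map (Matrix.toLin' (gridSubMatrix L M β
              (fun p : GridPoint L (2 * (2 * M)) => p.2) (fun p => gridTime β (2 * (2 * M)) p.1)))
            (∑ p' : GridPoint L (2 * (2 * M)), ∑ q' : GridPoint L (2 * (2 * M)), ∑ σ' : Fin 2,
            (if p' = q' then (0 : ℂ) else
              -((((U * (β / (2 * (2 * M) : ℕ)) : ℝ) : ℂ) ^ 2 *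
                (contr ℂ ((hubbardGridSub L M β (2 * (2 * M))).transpose * hubbardCovAboveCT L M β μ 0 0 klE0 *
                    hubbardGridSub L M β (2 * (2 * M))) (((q', σ'), 0) : GridLeg (GridPoint L (2 * (2 * M)))) ((p', σ'), 1) *
                  (contr ℂ ((hubbardGridSub L M β (2 * (2 * M))).transpose * hubbardCovAboveCT L M β μ 0 0 klE0 *
                      hubbardGridSub L M β (2 * (2 * M))) (((p', σ'.rev), 0) : GridLeg (GridPoint L (2 * (2 * M)))) ((q', σ'.rev), 1) *
                    contr ℂ ((hubbardGridSub L M β (2 * (2 * M))).transpose * hubbardCovAboveCT L M β μ 0 0 klE0 *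
                      hubbardGridSub L M β (2 * (2 * M))) (((q', σ'.rev), 0) : GridLeg (GridPoint L (2 * (2 * M)))) ((p', σ'.rev), 1)))))) •
              (gen ℂ (((p', σ'), 0) : GridLeg (GridPoint L (2 * (2 * M)))) * gen ℂ (((q', σ'), 1) : GridLeg (GridPoint L (2 * (2 * M))))))) (omega0 M, pp) σσ).re +
          (selfEnergy L M β (ExteriorAlgebra.map (Matrix.toLin' (gridSubMatrix L M β
              (fun p : GridPoint L (2 * (2 * M)) => p.2) (fun p => gridTime β (2 * (2 * M)) p.1)))
            (∑ p' : GridPoint L (2 * (2 * M)), ∑ q' : GridPoint L (2 * (2 * M)), ∑ σ' : Fin 2,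
            (if p' = q' then (0 : ℂ) else
              -((((U * (β / (2 * (2 * M) : ℕ)) : ℝ) : ℂ) ^ 2 *
                (contr ℂ ((hubbardGridSub L M β (2 * (2 * M))).transpose * hubbardCovAboveCT L M β μ 0 0 klE0 *
                    hubbardGridSub L M β (2 * (2 * M))) (((q', σ'), 0) : GridLeg (GridPoint L (2 * (2 * M)))) ((p', σ'), 1) *
                  (contr ℂ ((hubbardGridSub L M β (2 * (2 * M))).transpose * hubbardCovAboveCT L M β μ 0 0 klE0 *
                      hubbardGridSub L M β (2 * (2 * M))) (((p', σ'.rev), 0) : GridLeg (GridPoint L (2 * (2 * M)))) ((q', σ'.rev), 1) *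
                    contr ℂ ((hubbardGridSub L M β (2 * (2 * M))).transpose * hubbardCovAboveCT L M β μ 0 0 klE0 *
                      hubbardGridSub L M β (2 * (2 * M))) (((q', σ'.rev), 0) : GridLeg (GridPoint L (2 * (2 * M)))) ((p', σ'.rev), 1)))))) •
              (gen ℂ (((p', σ'), 0) : GridLeg (GridPoint L (2 * (2 * M)))) * gen ℂ (((q', σ'), 1) : GridLeg (GridPoint L (2 * (2 * M))))))) ((omega0 M).rev, pp) σσ).re)) / 4))
          (WithLp.toLp 2 (klFermiPoint μ 0 θ))) θ| ≤ sS k * U ^ 2) :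
    ∀ (P : SplitConsts) (R : RenConsts) (c : ℝ), P.WF → R.WF2 → 0 < c → c ≤ klEngC₃7GU G P R →
      ∀ μ ∈ klWindowC, ∀ U : ℝ, 0 < U → U ≤ klEngU₀12GQ G Q P R c → ∀ β : ℝ, klBetaMin ≤ β → β ≤ Real.exp (c / U ^ 2) →
        ∀ (L M : ℕ) [NeZero L] [NeZero M], klEngL₄ P R β U ≤ L → klEngM₃ β U L ≤ M →
          TwoLegReadJetBound L M klC4aJetC2 (klC4aJetC' P R) β U μ (klFlowFrameU L M β U μ 0) 0 ∧
            TwoLegReadOscAt L M (klReadOscC P R) β U μ (klFlowFrameU L M β U μ 0) 0 := by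
  refine twoLegRead_frameZero_registered_klEngGQ_of_records_certA G Q hA fun μ U β L M _ _ hμ hU hUb hβ hL hM => ?_
  obtain ⟨b, hb, -, -, hSk⟩ := sunsetRows_window_innerGap_of_chain (L := L) (M := M) l rs ω₁ u₀ u₂ hne hhead hlast hchain hc hr hrs hside hμ hβ hU
    (hUb.trans klTailBookU_le_half_pow_twenty) hL hM
  obtain ⟨f1, f2⟩ := hfit12 b hb
  have e1 : b.bSℝ 1 = ((b.bS 1 : ℚ) : ℝ) := SunsetCellBundle.bSℝ_fin b 1
  have e2 : b.bSℝ 2 = ((b.bS 2 : ℚ) : ℝ) := SunsetCellBundle.bSℝ_fin b 2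
  have f1' : ((b.bS 1 : ℚ) : ℝ) * ((319 : ℝ) / 100) + (1 + (319 : ℝ) / 100 + 2412 / 100 + 240 + 7430) ^ 4 / (10 : ℝ) ^ 78 ≤ (2 : ℝ) ^ 10 := by
    have h := (Rat.cast_le (K := ℝ)).2 f1; push_cast at h; exact h
  have f2' : ((b.bS 2 : ℚ) : ℝ) * ((319 : ℝ) / 100) ^ 2 + ((b.bS 1 : ℚ) : ℝ) * ((2412 : ℝ) / 100) + (1 + (319 : ℝ) / 100 + 2412 / 100 + 240 + 7430) ^ 4 / (10 : ℝ) ^ 78 ≤ (2 : ℝ) ^ 4 := by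
    have h := (Rat.cast_le (K := ℝ)).2 f2; push_cast at h; exact h
  refine ⟨b.bSℝ, sS, ⟨?_, ?_, hfit34.1, hfit34.2⟩, hSk, hSjetW μ U β L M hμ hU hUb hβ hL hM⟩
  · rw [e1]; exact f1'
  · rw [e1, e2]; exact f2'

end Summit.HubbardSuperconductivity.HubbardSuperconductivity.Theorems.KLRegimeSplit

end
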